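import Summits.AnomalousDissipation.AnomalousDissipation.Theorems.MarginalStabilityChainBurgersLayerLowReGreen
import Summits.AnomalousDissipation.AnomalousDissipation.Theorems.MarginalStabilityChainBurgersLayerLowReDecay

/-!
# Route MarginalStabilityChain · BurgersLayerLowRe — set-up and bookkeeping

Helper file (supports stmt-AnomalousDissipation-3010, `BurgersLayerLowRe`): derivatives of the vorticity
`ω = −(ψ'' − α²ψ)` of a `C⁴` stream function (`iteratedDeriv` calculus); the error-function profile
`U(y) = ∫₀ʸe^{−s²/2}` (derivative, oddness, bound); the Gaussian decomposition
`ω = ω(0)e^{−θy²/2} + ω⊥` with `N₁ = ∫(1+|y|)‖ω⊥‖` controlling `∫‖ω‖`, `∫|y|‖ω‖` and, together with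
the mass `∫ω`, the coefficient `ω(0)`; and the coupling bound `‖∫Vω‖ ≤ (K_U/α)N₁` for the odd Green
potential `V = TU` (with `∫ (odd)(even) = 0`). All folklore.
-/

noncomputable section

open MeasureTheory Set Filter Topology
open scoped Real RealInnerProductSpace Interval

namespace Summit.AnomalousDissipation.AnomalousDissipation.Theorems.MarginalStabilityChainBurgersLayerLowRe

-- the summit and its single sub-problem share the name `AnomalousDissipation` (tree layout D-0017)
set_option linter.dupNamespace false

open Literature.Analysis.ODE

/-! ### Set-up: the vorticity of a `C⁴` stream function, the error-function profile, constants -/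

section Setup

/-- First derivative of the vorticity `ω = −(ψ'' − c ψ)` of a `C⁴` stream function. [folklore] -/
theorem hasDerivAt_vorticity {ψ : ℝ → ℂ} (hψ : ContDiff ℝ 4 ψ) (c : ℂ) (y : ℝ) :
    HasDerivAt (fun u => -(iteratedDeriv 2 ψ u - c * ψ u)) (-(iteratedDeriv 3 ψ y - c * deriv ψ y)) y := by
  have h2 : HasDerivAt (iteratedDeriv 2 ψ) (iteratedDeriv 3 ψ y) y := by
    have hd : Differentiable ℝ (iteratedDeriv 2 ψ) := hψ.differentiable_iteratedDeriv 2 (by norm_num)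
    rw [(iteratedDeriv_succ : iteratedDeriv 3 ψ = deriv (iteratedDeriv 2 ψ))]
    exact (hd y).hasDerivAt
  have h0 : HasDerivAt ψ (deriv ψ y) y := (hψ.differentiable (by norm_num) y).hasDerivAt
  exact (h2.sub (h0.const_mul c)).neg

/-- Second derivative of the vorticity of a `C⁴` stream function. [folklore] -/
theorem hasDerivAt_vorticity' {ψ : ℝ → ℂ} (hψ : ContDiff ℝ 4 ψ) (c : ℂ) (y : ℝ) :
    HasDerivAt (fun u => -(iteratedDeriv 3 ψ u - c * deriv ψ u)) (-(iteratedDeriv 4 ψ y - c * iteratedDeriv 2 ψ y)) y := by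
  have h3 : HasDerivAt (iteratedDeriv 3 ψ) (iteratedDeriv 4 ψ y) y := by
    have hd : Differentiable ℝ (iteratedDeriv 3 ψ) := hψ.differentiable_iteratedDeriv 3 (by norm_num)
    rw [(iteratedDeriv_succ : iteratedDeriv 4 ψ = deriv (iteratedDeriv 3 ψ))]
    exact (hd y).hasDerivAt
  have h1 : HasDerivAt (deriv ψ) (iteratedDeriv 2 ψ y) y := by
    have hd : Differentiable ℝ (iteratedDeriv 1 ψ) := hψ.differentiable_iteratedDeriv 1 (by norm_num)
    rw [iteratedDeriv_succ, iteratedDeriv_one]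
    rw [iteratedDeriv_one] at hd
    exact (hd y).hasDerivAt
  exact (h3.sub (h1.const_mul c)).neg

/-- `deriv ω` for the vorticity of a `C⁴` stream function. [folklore] -/
theorem deriv_vorticity {ψ : ℝ → ℂ} (hψ : ContDiff ℝ 4 ψ) (c : ℂ) :
    deriv (fun u => -(iteratedDeriv 2 ψ u - c * ψ u)) = fun y => -(iteratedDeriv 3 ψ y - c * deriv ψ y) :=
  funext fun y => (hasDerivAt_vorticity hψ c y).deriv

/-- `iteratedDeriv 2 ω` for the vorticity of a `C⁴` stream function. [folklore] -/
theorem iteratedDeriv_two_vorticity {ψ : ℝ → ℂ} (hψ : ContDiff ℝ 4 ψ) (c : ℂ) :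
    iteratedDeriv 2 (fun u => -(iteratedDeriv 2 ψ u - c * ψ u)) = fun y => -(iteratedDeriv 4 ψ y - c * iteratedDeriv 2 ψ y) := by
  rw [iteratedDeriv_succ, iteratedDeriv_one, deriv_vorticity hψ c]
  exact funext fun y => (hasDerivAt_vorticity' hψ c y).deriv

/-- `ψ' ` has derivative `ψ'' = iteratedDeriv 2 ψ` for a `C⁴` (indeed `C²`) function. [folklore] -/
theorem hasDerivAt_deriv_of_contDiff {ψ : ℝ → ℂ} (hψ : ContDiff ℝ 4 ψ) (y : ℝ) :
    HasDerivAt (deriv ψ) (iteratedDeriv 2 ψ y) y := by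
  have hd : Differentiable ℝ (iteratedDeriv 1 ψ) := hψ.differentiable_iteratedDeriv 1 (by norm_num)
  rw [iteratedDeriv_succ, iteratedDeriv_one]
  rw [iteratedDeriv_one] at hd
  exact (hd y).hasDerivAt

/-- The Gaussian `e^{−s²/2}` is continuous. [folklore] -/
theorem continuous_gaussHalf : Continuous fun s : ℝ => Real.exp (-(s ^ 2) / 2) := by fun_prop

/-- **The error-function profile** `U(y) = ∫₀ʸ e^{−s²/2} ds` has derivative `e^{−y²/2}`. [folklore] -/
theorem hasDerivAt_erfProfile (y : ℝ) :
    HasDerivAt (fun u => ∫ s in (0 : ℝ)..u, Real.exp (-(s ^ 2) / 2)) (Real.exp (-(y ^ 2) / 2)) y :=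
  (continuous_gaussHalf.integral_hasStrictDerivAt 0 y).hasDerivAt

/-- `d/dy e^{−y²/2} = −y e^{−y²/2}` (the `U''` of the route statement). [folklore] -/
theorem hasDerivAt_gaussHalf (y : ℝ) :
    HasDerivAt (fun u : ℝ => Real.exp (-(u ^ 2) / 2)) (-(y * Real.exp (-(y ^ 2) / 2))) y := by
  have h1 : HasDerivAt (fun u : ℝ => -(u ^ 2) / 2) (-((2 : ℕ) * y ^ (2 - 1)) / 2) y :=
    ((hasDerivAt_pow 2 y).neg).div_const 2
  refine h1.exp.congr_deriv ?_
  simp only [Nat.cast_ofNat]; ring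

/-- The error-function profile is odd. [folklore] -/
theorem erfProfile_neg (y : ℝ) :
    ∫ s in (0 : ℝ)..(-y), Real.exp (-(s ^ 2) / 2) = -∫ s in (0 : ℝ)..y, Real.exp (-(s ^ 2) / 2) := by
  have h := intervalIntegral.integral_comp_neg (a := 0) (b := -y) (fun s : ℝ => Real.exp (-(s ^ 2) / 2))
  simp only [neg_neg, neg_zero, even_two, Even.neg_pow] at h
  rw [h, intervalIntegral.integral_symm]

/-- The error-function profile is bounded by `∫ e^{−s²/2} ds`. [folklore] -/
theorem abs_erfProfile_le (y : ℝ) :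
    |∫ s in (0 : ℝ)..y, Real.exp (-(s ^ 2) / 2)| ≤ ∫ s, Real.exp (-(1 / 2) * s ^ 2) := by
  have hint : Integrable fun s : ℝ => Real.exp (-(1 / 2) * s ^ 2) := integrable_exp_neg_mul_sq (by norm_num)
  have hfun : (fun s : ℝ => Real.exp (-(s ^ 2) / 2)) = fun s => Real.exp (-(1 / 2) * s ^ 2) := funext exp_half
  rw [hfun, ← Real.norm_eq_abs, intervalIntegral.norm_intervalIntegral_eq, Real.norm_of_nonneg
    (setIntegral_nonneg measurableSet_uIoc fun s _ => (Real.exp_pos _).le)]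
  exact setIntegral_le_integral hint (Eventually.of_forall fun s => (Real.exp_pos _).le)

/-- `√t ≤ 1 + t` for `t ≥ 0`. [folklore] -/
theorem sqrt_le_one_add {t : ℝ} (ht : 0 ≤ t) : Real.sqrt t ≤ 1 + t := by
  rw [Real.sqrt_le_iff]; constructor <;> nlinarith

end Setup


/-! ### Bookkeeping: the Gaussian decomposition `ω = ω(0)e^{−θy²/2} + ω⊥` and the coupling bound -/

section Prep

variable {α : ℝ}

/-- The integral of an odd function against an even one vanishes (no integrability needed: both sides
are `0` otherwise). [folklore] -/
theorem integral_odd_mul_even {V : ℝ → ℂ} {G : ℝ → ℝ} (hV : ∀ y, V (-y) = -V y) (hG : ∀ y, G (-y) = G y) :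
    ∫ y, V y * (G y : ℂ) = 0 := by
  have h : ∫ y, V y * (G y : ℂ) = -∫ y, V y * (G y : ℂ) := by
    conv_lhs => rw [← integral_neg_eq_self _ volume]
    rw [← integral_neg]
    refine integral_congr_ae (Eventually.of_forall fun y => ?_)
    simp only [hV, hG, neg_mul]
  linear_combination h / 2


/-- **Gaussian decomposition bounds.** For `θ ∈ [1/2, 1]` write `ω = ω(0) e^{−θy²/2} + ω⊥` and
`N₁ = ∫ (1+|y|)‖ω⊥‖`. Then `∫‖ω‖ ≤ N₁ + ‖ω(0)‖∫e^{−y²/4}`, `∫|y|‖ω‖ ≤ N₁ + ‖ω(0)‖∫|y|e^{−y²/4}` and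
`‖ω(0)‖ ∫e^{−y²/2} ≤ ‖∫ω‖ + N₁`. [folklore] -/
theorem gauss_decomposition_bounds {θ C : ℝ} (hθ : 1 / 2 ≤ θ) (hθ1 : θ ≤ 1) {ω : ℝ → ℂ} (hωc : Continuous ω)
    (hωb : ∀ y, ‖ω y‖ ≤ C * Real.exp (-(y ^ 2) / 4)) {N₁ : ℝ}
    (hN : N₁ = ∫ y, (1 + |y|) * ‖ω y - ((Real.exp (-(θ * y ^ 2 / 2)) : ℝ) : ℂ) * ω 0‖) :
    Integrable (fun y => (1 + |y|) * ‖ω y - ((Real.exp (-(θ * y ^ 2 / 2)) : ℝ) : ℂ) * ω 0‖) ∧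
    (∫ y, ‖ω y‖ ≤ N₁ + ‖ω 0‖ * ∫ y, Real.exp (-(1 / 4) * y ^ 2)) ∧
    (∫ y, |y| * ‖ω y‖ ≤ N₁ + ‖ω 0‖ * ∫ y, |y| * Real.exp (-(1 / 4) * y ^ 2)) ∧
    (‖ω 0‖ * ∫ y, Real.exp (-(1 / 2) * y ^ 2) ≤ ‖∫ y, ω y‖ + N₁) := by
  set G : ℝ → ℝ := fun y => Real.exp (-(θ * y ^ 2 / 2)) with hG
  set c₀ : ℂ := ω 0 with hc₀
  set w : ℝ → ℂ := fun y => ω y - ((G y : ℝ) : ℂ) * c₀ with hw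
  have hC0 : 0 ≤ C := by
    have h := hωb 0
    simp only [ne_eq, OfNat.ofNat_ne_zero, not_false_eq_true, zero_pow, neg_zero, zero_div, Real.exp_zero, mul_one] at h
    exact (norm_nonneg _).trans h
  have hGpos : ∀ y, 0 < G y := fun y => Real.exp_pos _
  have hGle : ∀ y, G y ≤ Real.exp (-(1 / 4) * y ^ 2) := fun y => by
    simp only [hG]; rw [Real.exp_le_exp]; nlinarith [sq_nonneg y]
  have hGge : ∀ y, Real.exp (-(1 / 2) * y ^ 2) ≤ G y := fun y => by
    simp only [hG]; rw [Real.exp_le_exp]; nlinarith [sq_nonneg y]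
  have hGc : Continuous G := by simp only [hG]; fun_prop
  have hwc : Continuous w := by simp only [hw]; fun_prop
  have iG : Integrable G := by
    have h := integrable_exp_neg_mul_sq (b := θ / 2) (by linarith)
    exact h.congr (Eventually.of_forall fun y => by simp only [hG]; congr 1; ring)
  have iyG : Integrable fun y => |y| * G y := by
    have h := (integrable_mul_exp_neg_mul_sq (b := θ / 2) (by linarith)).norm
    refine h.congr (Eventually.of_forall fun y => ?_)
    simp only [hG, norm_mul, Real.norm_eq_abs, abs_of_pos (Real.exp_pos _)]; congr 1; congr 1; ring
  have i4 : Integrable fun y : ℝ => Real.exp (-(1 / 4) * y ^ 2) := integrable_exp_neg_mul_sq (by norm_num)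
  have iy4 : Integrable fun y : ℝ => |y| * Real.exp (-(1 / 4) * y ^ 2) := by
    have h := (integrable_mul_exp_neg_mul_sq (b := 1 / 4) (by norm_num)).norm
    refine h.congr (Eventually.of_forall fun y => ?_)
    simp only [norm_mul, Real.norm_eq_abs, abs_of_pos (Real.exp_pos _)]
  -- pointwise bound on `w`
  have hwb : ∀ y, ‖w y‖ ≤ (C + ‖c₀‖) * Real.exp (-(1 / 4) * y ^ 2) := fun y => by
    simp only [hw]
    calc ‖ω y - ((G y : ℝ) : ℂ) * c₀‖ ≤ ‖ω y‖ + ‖((G y : ℝ) : ℂ) * c₀‖ := norm_sub_le _ _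
      _ ≤ C * Real.exp (-(1 / 4) * y ^ 2) + Real.exp (-(1 / 4) * y ^ 2) * ‖c₀‖ := by
          gcongr
          · rw [← exp_quarter]; exact hωb y
          · rw [norm_mul, Complex.norm_real, Real.norm_of_nonneg (hGpos y).le]
            exact mul_le_mul_of_nonneg_right (hGle y) (norm_nonneg _)
      _ = (C + ‖c₀‖) * Real.exp (-(1 / 4) * y ^ 2) := by ring
  have iN : Integrable fun y => (1 + |y|) * ‖w y‖ := by
    refine integrable_of_norm_le_gauss (by fun_prop) (by norm_num : (0 : ℝ) < 1 / 4) (A := C + ‖c₀‖)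
      (B := C + ‖c₀‖) (D := 0) fun y => ?_
    rw [Real.norm_eq_abs, abs_mul, abs_of_nonneg (by positivity : 0 ≤ 1 + |y|), abs_of_nonneg (norm_nonneg _)]
    calc (1 + |y|) * ‖w y‖ ≤ (1 + |y|) * ((C + ‖c₀‖) * Real.exp (-(1 / 4) * y ^ 2)) := by gcongr; exact hwb y
      _ = (C + ‖c₀‖ + (C + ‖c₀‖) * |y| + 0 * y ^ 2) * Real.exp (-(1 / 4) * y ^ 2) := by ring
  have iw : Integrable fun y => ‖w y‖ :=
    iN.mono' (by fun_prop) (Eventually.of_forall fun y => by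
      rw [Real.norm_of_nonneg (norm_nonneg _)]
      nlinarith [norm_nonneg (w y), abs_nonneg y])
  have iyw : Integrable fun y => |y| * ‖w y‖ :=
    iN.mono' (by fun_prop) (Eventually.of_forall fun y => by
      rw [Real.norm_of_nonneg (by positivity)]
      nlinarith [norm_nonneg (w y), abs_nonneg y])
  have iw' : Integrable w := (integrable_norm_iff hwc.aestronglyMeasurable).1 iw
  have hN₁w : ∫ y, ‖w y‖ ≤ N₁ := by
    rw [hN]
    exact integral_mono iw iN fun y => by dsimp only; nlinarith [norm_nonneg (w y), abs_nonneg y]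
  have hN₁yw : ∫ y, |y| * ‖w y‖ ≤ N₁ := by
    rw [hN]
    exact integral_mono iyw iN fun y => by dsimp only; nlinarith [norm_nonneg (w y), abs_nonneg y]
  have hdecomp : ∀ y, ω y = w y + ((G y : ℝ) : ℂ) * c₀ := fun y => by simp only [hw]; ring
  refine ⟨iN, ?_, ?_, ?_⟩
  · -- `∫‖ω‖`
    have h1 : ∀ y, ‖ω y‖ ≤ ‖w y‖ + ‖c₀‖ * Real.exp (-(1 / 4) * y ^ 2) := fun y => by
      rw [hdecomp y]
      refine (norm_add_le _ _).trans (add_le_add le_rfl ?_)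
      rw [norm_mul, Complex.norm_real, Real.norm_of_nonneg (hGpos y).le, mul_comm]
      exact mul_le_mul_of_nonneg_left (hGle y) (norm_nonneg _)
    calc ∫ y, ‖ω y‖ ≤ ∫ y, (‖w y‖ + ‖c₀‖ * Real.exp (-(1 / 4) * y ^ 2)) :=
          integral_mono ((integrable_norm_iff hωc.aestronglyMeasurable).2
            ((integrable_congr (Eventually.of_forall hdecomp)).2 (iw'.add ((iG.ofReal (𝕜 := ℂ)).mul_const c₀))))
            (iw.add (i4.const_mul _)) h1
      _ = (∫ y, ‖w y‖) + ‖c₀‖ * ∫ y, Real.exp (-(1 / 4) * y ^ 2) := by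
          rw [integral_add iw (i4.const_mul _), integral_const_mul]
      _ ≤ N₁ + ‖ω 0‖ * ∫ y, Real.exp (-(1 / 4) * y ^ 2) := by rw [hc₀]; linarith
  · -- `∫|y|‖ω‖`
    have h1 : ∀ y, |y| * ‖ω y‖ ≤ |y| * ‖w y‖ + ‖c₀‖ * (|y| * Real.exp (-(1 / 4) * y ^ 2)) := fun y => by
      rw [hdecomp y]
      have h2 : ‖((G y : ℝ) : ℂ) * c₀‖ ≤ Real.exp (-(1 / 4) * y ^ 2) * ‖c₀‖ := by
        rw [norm_mul, Complex.norm_real, Real.norm_of_nonneg (hGpos y).le]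
        exact mul_le_mul_of_nonneg_right (hGle y) (norm_nonneg _)
      calc |y| * ‖w y + ((G y : ℝ) : ℂ) * c₀‖ ≤ |y| * (‖w y‖ + Real.exp (-(1 / 4) * y ^ 2) * ‖c₀‖) := by
            gcongr; exact (norm_add_le _ _).trans (add_le_add le_rfl h2)
        _ = |y| * ‖w y‖ + ‖c₀‖ * (|y| * Real.exp (-(1 / 4) * y ^ 2)) := by ring
    have iyω : Integrable fun y => |y| * ‖ω y‖ := by
      refine integrable_of_norm_le_gauss (by fun_prop) (by norm_num : (0 : ℝ) < 1 / 4) (A := 0) (B := C) (D := 0)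
        fun y => ?_
      rw [Real.norm_eq_abs, abs_mul, abs_abs, abs_of_nonneg (norm_nonneg _), ← exp_quarter]
      calc |y| * ‖ω y‖ ≤ |y| * (C * Real.exp (-(y ^ 2) / 4)) := by gcongr; exact hωb y
        _ = (0 + C * |y| + 0 * y ^ 2) * Real.exp (-(y ^ 2) / 4) := by ring
    calc ∫ y, |y| * ‖ω y‖ ≤ ∫ y, (|y| * ‖w y‖ + ‖c₀‖ * (|y| * Real.exp (-(1 / 4) * y ^ 2))) :=
          integral_mono iyω (iyw.add (iy4.const_mul _)) h1
      _ = (∫ y, |y| * ‖w y‖) + ‖c₀‖ * ∫ y, |y| * Real.exp (-(1 / 4) * y ^ 2) := by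
          rw [integral_add iyw (iy4.const_mul _), integral_const_mul]
      _ ≤ N₁ + ‖ω 0‖ * ∫ y, |y| * Real.exp (-(1 / 4) * y ^ 2) := by rw [hc₀]; linarith
  · -- the mass controls `ω(0)`
    have iGc : Integrable fun y => ((G y : ℝ) : ℂ) * c₀ := (iG.ofReal (𝕜 := ℂ)).mul_const c₀
    have hm : ∫ y, ω y = (∫ y, w y) + ((∫ y, G y : ℝ) : ℂ) * c₀ := by
      rw [integral_congr_ae (Eventually.of_forall hdecomp), integral_add iw' iGc, integral_mul_const, integral_complex_ofReal]
    have hG0 : 0 ≤ ∫ y, G y := integral_nonneg fun y => (hGpos y).le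
    have hGint : ∫ y, Real.exp (-(1 / 2) * y ^ 2) ≤ ∫ y, G y :=
      integral_mono (integrable_exp_neg_mul_sq (by norm_num)) iG hGge
    have h1 : ‖c₀‖ * ∫ y, G y ≤ ‖∫ y, ω y‖ + N₁ := by
      have h2 : ((∫ y, G y : ℝ) : ℂ) * c₀ = (∫ y, ω y) - ∫ y, w y := by rw [hm]; ring
      have h3 : ‖((∫ y, G y : ℝ) : ℂ) * c₀‖ = ‖c₀‖ * ∫ y, G y := by
        rw [norm_mul, Complex.norm_real, Real.norm_of_nonneg hG0, mul_comm]
      rw [← h3, h2]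
      refine (norm_sub_le _ _).trans (add_le_add le_rfl ?_)
      exact (norm_integral_le_integral_norm _).trans hN₁w
    calc ‖ω 0‖ * ∫ y, Real.exp (-(1 / 2) * y ^ 2) ≤ ‖c₀‖ * ∫ y, G y := by
          rw [hc₀]; exact mul_le_mul_of_nonneg_left hGint (norm_nonneg _)
      _ ≤ ‖∫ y, ω y‖ + N₁ := h1

/-- **The coupling bound.** For the odd bounded profile `U` (`|U| ≤ K_U`) the Green potential `V = TU`
is odd with `‖V(y)‖ ≤ (K_U/α)|y|`, and `∫ V e^{−θy²/2} = 0`; hence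
`‖∫ V ω‖ ≤ (K_U/α) ∫ (1+|y|)‖ω − ω(0)e^{−θy²/2}‖`. [folklore] -/
theorem norm_integral_green_mul_le (hα : 0 < α) {U : ℝ → ℝ} {KU : ℝ} (hUc : Continuous U) (hUb : ∀ y, |U y| ≤ KU)
    (hUodd : ∀ y, U (-y) = -U y) {V : ℝ → ℂ}
    (hV : V = fun y => (2 * (α : ℂ))⁻¹ * ∫ s, ((Real.exp (-(α * |y - s|)) : ℝ) : ℂ) * (U s : ℂ))
    {θ : ℝ} (hθ : 0 < θ) {ω : ℝ → ℂ} (hωc : Continuous ω)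
    (iN : Integrable fun y => (1 + |y|) * ‖ω y - ((Real.exp (-(θ * y ^ 2 / 2)) : ℝ) : ℂ) * ω 0‖) :
    ‖∫ y, V y * ω y‖ ≤ KU / α * ∫ y, (1 + |y|) * ‖ω y - ((Real.exp (-(θ * y ^ 2 / 2)) : ℝ) : ℂ) * ω 0‖ := by
  have hUcc : Continuous fun y => (U y : ℂ) := by fun_prop
  have hUcb : ∀ y, ‖(U y : ℂ)‖ ≤ KU := fun y => by rw [Complex.norm_real, Real.norm_eq_abs]; exact hUb y
  have hKU : 0 ≤ KU := (abs_nonneg _).trans (hUb 0)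
  obtain ⟨V', hV1, -, hV'b⟩ := green_hasDerivAt hα hUcc hUcb hV
  have hVc : Continuous V := green_continuous hα hUcc hUcb hV
  have hVb : ∀ y, ‖V y‖ ≤ KU / α ^ 2 := green_norm_le hα hUcc hUcb hV
  have hVodd : ∀ y, V (-y) = -V y := green_odd (fun s => by push_cast [hUodd s]; ring) hV
  have hV0 : V 0 = 0 := by
    have h := hVodd 0; rw [neg_zero] at h
    have : (2 : ℂ) * V 0 = 0 := by linear_combination h
    simpa using this
  -- Lipschitz bound from `V(0) = 0`
  have hVlip : ∀ y, ‖V y‖ ≤ KU / α * |y| := fun y => by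
    have h := Convex.norm_image_sub_le_of_norm_hasDerivWithin_le (f := V) (f' := V') (s := Set.univ) (x := 0) (y := y)
      (fun x _ => (hV1 x).hasDerivWithinAt) (fun x _ => hV'b x) convex_univ (mem_univ _) (mem_univ _)
    rw [hV0, sub_zero, sub_zero, Real.norm_eq_abs] at h
    exact h
  set G : ℝ → ℝ := fun y => Real.exp (-(θ * y ^ 2 / 2)) with hG
  set w : ℝ → ℂ := fun y => ω y - ((G y : ℝ) : ℂ) * ω 0 with hw
  have hGc : Continuous G := by simp only [hG]; fun_prop
  have hwc : Continuous w := by simp only [hw]; fun_prop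
  have iG : Integrable G := by
    have h := integrable_exp_neg_mul_sq (b := θ / 2) (by linarith)
    exact h.congr (Eventually.of_forall fun y => by simp only [hG]; congr 1; ring)
  have hdecomp : ∀ y, V y * ω y = V y * w y + (V y * ((G y : ℝ) : ℂ)) * ω 0 := fun y => by simp only [hw]; ring
  have iVw : Integrable fun y => V y * w y := by
    refine (iN.const_mul (KU / α)).mono' (by fun_prop) (Eventually.of_forall fun y => ?_)
    rw [norm_mul]
    calc ‖V y‖ * ‖w y‖ ≤ (KU / α * |y|) * ‖w y‖ := by gcongr; exact hVlip y
      _ ≤ KU / α * ((1 + |y|) * ‖w y‖) := by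
          have : 0 ≤ KU / α := div_nonneg hKU hα.le
          nlinarith [norm_nonneg (w y), abs_nonneg y]
      _ = KU / α * ((1 + |y|) * ‖ω y - ((G y : ℝ) : ℂ) * ω 0‖) := by simp only [hw]
  have iVG : Integrable fun y => (V y * ((G y : ℝ) : ℂ)) * ω 0 := by
    refine Integrable.mul_const ?_ _
    exact (iG.ofReal (𝕜 := ℂ)).bdd_mul (c := KU / α ^ 2) hVc.aestronglyMeasurable (Eventually.of_forall hVb)
  have hzero : ∫ y, (V y * ((G y : ℝ) : ℂ)) * ω 0 = 0 := by
    rw [integral_mul_const, integral_odd_mul_even hVodd (fun y => by simp only [hG]; congr 1; ring), zero_mul]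
  rw [integral_congr_ae (Eventually.of_forall hdecomp), integral_add iVw iVG, hzero, add_zero]
  calc ‖∫ y, V y * w y‖ ≤ ∫ y, KU / α * ((1 + |y|) * ‖ω y - ((G y : ℝ) : ℂ) * ω 0‖) := by
        refine norm_integral_le_of_norm_le (iN.const_mul _) (Eventually.of_forall fun y => ?_)
        rw [norm_mul]
        calc ‖V y‖ * ‖w y‖ ≤ (KU / α * |y|) * ‖w y‖ := by gcongr; exact hVlip y
          _ ≤ KU / α * ((1 + |y|) * ‖w y‖) := by
              have : 0 ≤ KU / α := div_nonneg hKU hα.le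
              nlinarith [norm_nonneg (w y), abs_nonneg y]
          _ = KU / α * ((1 + |y|) * ‖ω y - ((G y : ℝ) : ℂ) * ω 0‖) := by simp only [hw]
    _ = KU / α * ∫ y, (1 + |y|) * ‖ω y - ((G y : ℝ) : ℂ) * ω 0‖ := integral_const_mul _ _

end Prep


/-- `e^{−θy²/4} ≤ e^{−y²/8}` for `θ ≥ 1/2`. [folklore] -/
theorem exp_neg_theta_quarter_le {θ : ℝ} (hθ : 1 / 2 ≤ θ) (y : ℝ) :
    Real.exp (-(θ * y ^ 2 / 4)) ≤ Real.exp (-(1 / 8) * y ^ 2) := by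
  rw [Real.exp_le_exp]; nlinarith [sq_nonneg y]

/-- `(1 + |y|)√|y| ≤ 1 + 2|y| + y²`. [folklore] -/
theorem one_add_abs_mul_sqrt_le (y : ℝ) : (1 + |y|) * Real.sqrt |y| ≤ 1 + 2 * |y| + y ^ 2 := by
  have h5 := sqrt_le_one_add (abs_nonneg y)
  have h6 : |y| ^ 2 = y ^ 2 := sq_abs y
  nlinarith [abs_nonneg y, Real.sqrt_nonneg |y|]

/-- If `0 ≤ K`, `0 ≤ r < 1/(K+1)` then `rK < 1`. [folklore] -/
theorem mul_lt_one_of_lt_inv {r K : ℝ} (hK : 0 ≤ K) (hr : 0 ≤ r) (h : r < 1 / (K + 1)) : r * K < 1 := by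
  have h2 : r * (K + 1) < 1 := by rwa [lt_div_iff₀ (by positivity)] at h
  nlinarith

/-- `e^{−y²/4} ≤ 1`. [folklore] -/
theorem exp_quarter_le_one (y : ℝ) : Real.exp (-(y ^ 2) / 4) ≤ 1 := by
  rw [Real.exp_le_one_iff]; nlinarith [sq_nonneg y]

end Summit.AnomalousDissipation.AnomalousDissipation.Theorems.MarginalStabilityChainBurgersLayerLowRe
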